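import Summits.AnomalousDissipation.AnomalousDissipation.Theorems.BaireTransferRobustLoudUpgradeStubSegmentSteady

/-!
# Stub `stub_segmentSteadyForce` of the line `malkin-cone-group-orbits` (crux stmt-AnomalousDissipation-1144, lead c14,
# cycle 2): the designer segment `t ↦ (t•u₀, t²f + (t²−t)ν Δu₀)` of an ARBITRARY force consists of exact steady states

Registered signature (proved here, textually):
`theorem stub_segmentSteadyForce : ∀ (ν t : ℝ) (f u₀ : UnitAddTorus (Fin 3) → EuclideanSpace ℝ (Fin 3))
(p₀ : UnitAddTorus (Fin 3) → ℝ), Torus.IsSteadyNSState ν f u₀ p₀ →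
Torus.IsSteadyNSState ν (fun x => t ^ 2 • f x + ((t ^ 2 - t) * ν) • laplacian u₀ x) (fun x => t • u₀ x)
(fun x => t ^ 2 * p₀ x)`.

If `u₀` is a classical steady state of `NS_ν(f)` with pressure `p₀`, then for every real `t` the rescaled field `t•u₀`
with pressure `t²p₀` is a classical steady state of `NS_ν` (SAME viscosity) forced by `t²f + (t²−t)ν Δu₀`: indeed
`(t u₀·∇)(t u₀) − νΔ(t u₀) + ∇(t²p₀) = t²((u₀·∇)u₀ + ∇p₀) − tνΔu₀ = t²(f + νΔu₀) − tνΔu₀ = t² f + (t² − t)ν Δu₀`.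
This is the algebra of the sibling `SegmentSteady.stub_segmentSteady` without the trigonometric-polynomial force family;
the pointwise calculus is `Torus.fderiv_const_smul`, `Torus.gradient_const_smul`, `Torus.laplacian_const_smul_apply`,
`Torus.divergence_const_smul`, and the vanishing time derivative of constant data is
`SegmentSteady.timeDerivWithin_const_field`.  Pure proof file (no definitions).
-/

-- `Summit.<Summit>.<Problem>` is the tree's mandated summit-side namespace (CONVENTIONS §2); for this
-- single-conjunct summit the two coincide, so the duplicate is deliberate.
set_option linter.dupNamespace false

noncomputable section

open scoped BigOperators Topology
open Filter Set Function TopologicalSpace MeasureTheory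

namespace Summit.AnomalousDissipation.AnomalousDissipation.Theorems.RobustLoudUpgrade.Poly.SegmentSteadyForce

open Literature.Analysis.FunctionSpaces Literature.Analysis.FunctionSpaces.Torus
open Literature.Analysis.FluidPDE
open Summit.AnomalousDissipation.AnomalousDissipation.Theses.BaireTransfer

/-- The convective term is quadratic under constant rescaling: `((t u)·∇)(t u) = t² (u·∇)u` for `C¹` fields.
[folklore] -/
theorem convect_const_smul {u : UnitAddTorus (Fin 3) → EuclideanSpace ℝ (Fin 3)} (hu : IsSmooth u) (t : ℝ)
    (x : UnitAddTorus (Fin 3)) :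
    Torus.convect (fun y => t • u y) (fun y => t • u y) x = t ^ 2 • Torus.convect u u x := by
  change Torus.fderiv (t • u) x (t • u x) = _
  rw [Torus.fderiv_const_smul (hu.isContDiff (by simp)), FunLike.coe_smul, Pi.smul_apply, map_smul, smul_smul,
    ← pow_two]
  rfl

/-- **The registered stub `stub_segmentSteadyForce`** (the designer segment of an arbitrary force is a segment of EXACT
steady states at the same viscosity): if `u₀` is a classical steady state of `NS_ν(f)` with pressure `p₀`, then `t•u₀`
is a classical steady state of `NS_ν(t²f + (t²−t)ν Δu₀)` with pressure `t²p₀`. [folklore] -/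
theorem stub_segmentSteadyForce :
    ∀ (ν t : ℝ) (f u₀ : UnitAddTorus (Fin 3) → EuclideanSpace ℝ (Fin 3)) (p₀ : UnitAddTorus (Fin 3) → ℝ),
      Torus.IsSteadyNSState ν f u₀ p₀ →
      Torus.IsSteadyNSState ν (fun x => t ^ 2 • f x + ((t ^ 2 - t) * ν) • laplacian u₀ x) (fun x => t • u₀ x)
        (fun x => t ^ 2 * p₀ x) := by
  intro ν t f u₀ p₀ hst
  have hu : IsSmooth u₀ := hst.smooth_velocity.isSmooth_slice (Set.mem_univ 0)
  have hp : IsSmooth p₀ := hst.smooth_pressure.isSmooth_slice (Set.mem_univ 0)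
  refine ⟨hst.smooth_velocity.const_smul t, ?_, fun s _ x => ?_, fun s _ x => ?_⟩
  · -- joint smoothness of the rescaled pressure
    simpa only [smul_eq_mul] using hst.smooth_pressure.const_smul (t ^ 2)
  · -- the momentum equation along the segment
    have h3 : Torus.gradient (fun y => t ^ 2 * p₀ y) x = t ^ 2 • Torus.gradient p₀ x := by
      change Torus.gradient (t ^ 2 • p₀) x = _
      exact Torus.gradient_const_smul (hp.isContDiff (by simp)) _ _
    have h4 : Torus.laplacian (fun y => t • u₀ y) x = t • Torus.laplacian u₀ x := by
      change Torus.laplacian (t • u₀) x = _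
      exact Torus.laplacian_const_smul_apply hu t x
    have hm := hst.momentum s (Set.mem_univ s) x
    rw [SegmentSteady.timeDerivWithin_const_field, zero_add] at hm
    rw [SegmentSteady.timeDerivWithin_const_field, zero_add, convect_const_smul hu, h3, h4]
    linear_combination (norm := module) t ^ 2 • hm
  · -- incompressibility along the segment
    change Torus.divergence (t • u₀) x = 0
    rw [Torus.divergence_const_smul (hu.isContDiff (by simp)), hst.divFree 0 (Set.mem_univ 0) x, mul_zero]

end Summit.AnomalousDissipation.AnomalousDissipation.Theorems.RobustLoudUpgrade.Poly.SegmentSteadyForce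

end
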